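import Summits.BirchSwinnertonDyer.Rank1Residual.P2.CMKolyvaginOptimalPartnerAtTwo
import Summits.BirchSwinnertonDyer.BirchSwinnertonDyer.Theorems.ManinLocalTwoThreeManinOddAtFourEtaTwo
import Literature.NumberTheory.EllipticCurves.BarriosEtAl2025.QuadraticTwistAtTwoConductorProofs
import Literature.NumberTheory.EllipticCurves.QuadraticTwistMinimalModelProofs
import Literature.NumberTheory.EllipticCurves.QuadraticTwistIntegralModel
import Literature.NumberTheory.EllipticCurves.QuadraticTwistJInvariantProofs
import Literature.NumberTheory.EllipticCurves.ComplexMultiplicationShaKnappProofs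
import Literature.NumberTheory.EllipticCurves.RootNumberSmulProofs
import Literature.NumberTheory.EllipticCurves.SzpiroLocalDataProofs
import Literature.NumberTheory.EllipticCurves.OrdinaryPrimesProofs
import Literature.NumberTheory.EllipticCurves.ModularityVersionApProofs
import Literature.NumberTheory.EllipticCurves.CuspFormLFunctionLevelConductorProofs
import Literature.NumberTheory.EllipticCurves.IsogenyIdProofs
import HarnessLib

/-!
# Route `ShiftedKolyvaginAtInertTwo` (leaf `WAllCornerFTwo`), crux `OddManinCMInertTwoR`
# (stmt-BirchSwinnertonDyer-26780): on the five odd-Heegner classes THE MANIN CRUX IS A THEOREM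
# MODULO PRINTS — the dyadic twist road (Stevens 1989 §5 at `2`; cell `bsd-f2-manin`'s `η = 2` law)

Cell `bsd-print-cf2`, seat ty2 (discharge interface: leaf predicate ⟹ the cited theorems' hypotheses).
HONEST FRAMING: THEOREMS ONLY — no definition, no named fact, no route file imported, nothing about BSD
asserted or booked; the leaf `Summit.BirchSwinnertonDyer.WAllCornerFTwo`, the route's research cruxes
`RefinedKolyvaginAtInertTwo` / `ShiftedKolyvaginExactAtInertTwo` and crux 26780 AS TYPED (whole habitat)
are OPEN. Manin's conjecture and BSD are NOT proved by any of this.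

## What is proved

The repaired Manin crux 26780 asks, on the habitat `H₂` (CM by a maximal order with `2` inert, `ρ̄₂`
onto, analytic rank `1`), that every LATTICE-OPTIMAL `X₀(N)`-datum `Dt` of a globally minimal `W`
(`Λ_W ⊆ c·Λ_f`) has odd `c`. The route's `closes` consumes it only on the five odd-Heegner classes
(`j(W) ∈ {−2¹⁵, −2¹⁵3³, −2¹⁸3³5³, −2¹⁵3³5³11³, −2¹⁸3³5³23³29³}` = every quadratic twist of
`121b1, 361a1, 1849a1, 4489a1, 26569a1` = `cm11, cm19, cm43, cm67, cm163`). On that slice it is a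
THEOREM modulo four printed facts, taken BY NAME as hypotheses (`hM` Mazur 1978 Cor. 4.1, `hAU`
Abbes–Ullmo 1996 Thm. A, `hC2` Česnavičius 2018 Thm. 1.2 at `2 ∥ N`, `hnf` modularity):

* §1 `conductorExponent_quadraticTwist_eq_of_not_dvd` — at a place `v ∤ 2m` with `m ≡ 1 (mod 4)` the
  twist by `m` does not change `f_v` (unramified twist: `E^{(m)} ≅ E.twistModel ((m−1)/4)`, tree
  `conductorExponent_twistModel`, Comalada 1994 §2 / Silverman ATAEC IV.9.4); and
  `conductorExponent_quadraticTwist_eq_of_odd_place` — at an odd place `v ∤ d` the twist by ANY `d` does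
  not change `f_v` (same mechanism; generalises `bsd-f2-manin`'s dyadic `maninLocalTwoThree_conductorExponent_…`,
  whose file imports another route's Theses file and is therefore not imported here).
* §2 `dyadicTwist_bookkeeping_of_hasGoodReductionAtPrime_two` — for `V` globally minimal GOOD at `2`,
  `d₂ ∈ {−1, 2, −2}` and any model `W` of `V^{(d₂)}` (`C • W = V.quadraticTwist d₂`):
  `W ∼ V^{(d₂)}`, `N(V) ∣ N(W)`, `(4|d₂|)² ∣ N(W)`, `4 ∤ N(V)`, and `W` is ADDITIVE at `2` — the displayed
  hypotheses of `ManinAdditive.TwoNotDvdManinOfTwistOfSemistableAtTwo`; by Barrios et al. 2025 Thm. 5.1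
  (`f₂(V^{(d₂)}) = 4, 6`, tree theorem `conductorExponent_quadraticTwist_two_of_le_one_holds`), §1, and
  Ogg/`not_good_and_not_mult_of_sq_dvd_conductorNorm`.
* §3 `odd_c_of_latticeOptimal_of_smul_eq_quadraticTwist_of_hasGoodReductionAtPrime_two` — THE ENGINE,
  for ANY globally minimal base `E` good at `2` and ANY square-free `d ≠ 0`: every lattice-optimal datum
  (any level) of every globally minimal model `W` of `E^{(d)}` has odd `c`, modulo `hM hAU hC2 hnf`.
  `d ≡ 1 (4)`: `W` is good at `2` (§1), level = conductor (`hnf`), Abbes–Ullmo at `p = 2`. `d ≡ 3 (4)`: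
  `W ≅ (E^{(−d)})^{(−1)}`; `d = 2m'`: `W ≅ (E^{(±m')})^{(±2)}` with `±m' ≡ 1 (4)`
  (`emod_four_eq_one_or_exists_dyadic`); the partner `E^{(m*)}` is good at `2` (§1); §2; then the tree
  theorem `Theorems.twoNotDvdManinOfTwistOfSemistableAtTwo_holds` (cell `bsd-f2-manin`, crux
  `ManinOddAtFour`, line `dyadic-twist`: Stevens 1989 Lemmas (5.2)/(5.4) on `Γ₀` for `η = 1` +
  its PROVED `η = 2` law `TwoNotDvdManinOfTwistEtaTwo`) with `W₀ := W`.
* §4 (sibling file `CMKolyvaginOddManinTwistRoadAtTwoClasses.lean`) `odd_c_of_latticeOptimal_of_j_oddHeegner`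
  — THE CLASS DOOR on the five odd-Heegner classes (each base good at `2`, `Δ_min = −q³`), and
  `oddManinCMInertTwoR_of_j_oddHeegner_of_print` — the BODY OF CRUX 26780 VERBATIM with the binder
  `j(W) ∈ five` added: exactly what `closes` (rev 11) applies after `intro W _ _ _ Dt hoptDt hr hj`.

What is NOT covered (numbers, not adjectives): crux 26780 AS TYPED quantifies over ALL of `H₂`, whose
`j = 0` sector (Mordell curves `y² = x³ + k`, `k` not a cube; `27a4`-type twists — the sibling route
`CMKolyvaginAtInertTwo`) contains classes that are NOT dyadic twists of a class semistable at `2`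
(semistability defect `e₂ ∈ {3, 4, 6, 8, 24}`); there the only tree doors are Cremona `N ≤ 300000`
(`OptimalPartner.oddManin_latticeOptimal_of_conductorNorm_le_300000`) and good-at-2 (Abbes–Ullmo), and
the residual is `bsd-f2-manin`'s open core `stub_twistMinimalAtTwo`. `closes` never uses that sector.

References: [Stevens1989] Lemmas (5.2), (5.4), (5.6)–(5.7) pp. 96–98; [Cesnavicius2018] Thm. 1.2;
[Mazur1978] Cor. 4.1; [AbbesUllmo1996] Thm. A; [BarriosEtAl2025] Thm. 5.1 rows `I₀`, column `(f, f^d)`;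
[SilvermanATAEC1994] IV.9.4, IV.10–11, App. A §3; [SilvermanAEC2009] VII.1 Rem. 1.1, X.5 Cor. 5.4.1;
[Comalada1994] §2; [Pal2012] Prop. 2.4, Lemma 3.1; [AgasheRibetStein2006] §2.
-/

set_option autoImplicit false

noncomputable section

open scoped Classical

open WeierstrassCurve IsDedekindDomain IsDedekindDomain.HeightOneSpectrum Rat.HeightOneSpectrum
  Literature.NumberTheory.EllipticCurves Literature.NumberTheory.EllipticCurves.ModularForms
  Literature.NumberTheory.EllipticCurves.BarriosEtAl2025
  Summit.BirchSwinnertonDyer.Rank1Residual.ManinAdditive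
  Summit.BirchSwinnertonDyer.Rank1Residual.P2

namespace Summit.BirchSwinnertonDyer.Rank1Residual.P2.OddManinTwistRoad

/-! ## §1 Unramified twists do not change the conductor exponent -/

/-- **At a place `v ∤ 2m`, `m ≡ 1 (mod 4)`, the twist by `m` does not change `f_v`.** With
`k = (m − 1)/4 ∈ ℤ` (`|k|_v ≤ 1`, `|4k + 1|_v = |m|_v = 1`): `E^{(m)} ≅ E.twistModel k`
(`exists_variableChange_twistModel_eq_quadraticTwist`), `f_v(E.twistModel k) = f_v(E)`
(`conductorExponent_twistModel`), and `f_v` is an isomorphism invariant (`conductorExponent_smul'`).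
In particular at `v = 2` for every odd `m ≡ 1 (mod 4)`.
[cite: SilvermanATAEC1994, IV.9.4 (PDF pp. 344–346)] [cite: Comalada1994, §2] -/
theorem conductorExponent_quadraticTwist_eq_of_not_dvd (V : WeierstrassCurve ℚ) [V.IsElliptic]
    {m : ℤ} (hm : m % 4 = 1) (v : HeightOneSpectrum ℤ) (hv : ¬ (natGenerator v : ℤ) ∣ m) :
    (V.quadraticTwist (m : ℚ)).conductorExponent v = V.conductorExponent v := by
  have hm0 : m ≠ 0 := by omega
  have hd0 : (m : ℚ) ≠ 0 := by exact_mod_cast hm0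
  obtain ⟨k, hk⟩ : ∃ k : ℤ, m = 4 * k + 1 := ⟨m / 4, by omega⟩
  have hdv : v.valuation ℚ (m : ℚ) = 1 :=
    (Literature.NumberTheory.EllipticCurves.Rat.valuation_intCast_eq_one_iff v m).mpr hv
  have hkv : v.valuation ℚ (k : ℚ) ≤ 1 := by
    rw [show ((k : ℚ)) = algebraMap ℤ ℚ k by rw [eq_intCast]]
    exact HeightOneSpectrum.valuation_le_one v k
  have hk4 : 4 * (k : ℚ) + 1 = (m : ℚ) := by rw [hk]; push_cast; ring
  have hk1 : v.valuation ℚ (4 * (k : ℚ) + 1) = 1 := by rw [hk4]; exact hdv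
  obtain ⟨C₁, -, hC₁⟩ := exists_variableChange_twistModel_eq_quadraticTwist V (k : ℚ)
  rw [hk4] at hC₁
  haveI : (V.twistModel (k : ℚ)).IsElliptic := by
    refine ⟨?_⟩
    rw [twistModel_Δ, hk4]
    exact (IsUnit.mk0 _ (pow_ne_zero 6 hd0)).mul V.isUnit_Δ
  haveI : (V.quadraticTwist (m : ℚ)).IsElliptic := V.isElliptic_quadraticTwist hd0
  rw [← hC₁, conductorExponent_smul']
  exact conductorExponent_twistModel v V hkv hk1

/-- **At an ODD place `v ∤ d`, the twist by `d` does not change `f_v`** (any `d`; the twist is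
unramified at `v`: `d = 4k + 1` with `k = (d − 1)/4` `v`-integral since `|4|_v = 1`, and
`|4k + 1|_v = |d|_v = 1`). Generalises (to every `d` prime to `v`) the dyadic case `d ∈ {−1, 2, −2}`
landed by cell `bsd-f2-manin` as `Theorems.maninLocalTwoThree_conductorExponent_quadraticTwist_eq_of_ne_two`
(whose module imports the route file `Theses.ManinLocalTwoThree` and is deliberately not imported into
this route-`B`-facing file). [cite: SilvermanATAEC1994, IV.9.4 (PDF pp. 344–346)] [cite: Comalada1994, §2] -/
theorem conductorExponent_quadraticTwist_eq_of_odd_place (V : WeierstrassCurve ℚ) [V.IsElliptic]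
    {d : ℤ} (v : HeightOneSpectrum ℤ) (hv : natGenerator v ≠ 2) (hvd : ¬ (natGenerator v : ℤ) ∣ d) :
    (V.quadraticTwist (d : ℚ)).conductorExponent v = V.conductorExponent v := by
  have hgen : (natGenerator v).Prime := prime_natGenerator v
  have hdne : d ≠ 0 := fun h ↦ hvd (h ▸ dvd_zero _)
  have hd0 : (d : ℚ) ≠ 0 := by exact_mod_cast hdne
  have hdv : v.valuation ℚ (d : ℚ) = 1 :=
    (Literature.NumberTheory.EllipticCurves.Rat.valuation_intCast_eq_one_iff v d).mpr hvd
  have h4v : v.valuation ℚ (4 : ℚ) = 1 := by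
    rw [show (4 : ℚ) = ((4 : ℤ) : ℚ) by norm_num,
      Literature.NumberTheory.EllipticCurves.Rat.valuation_intCast_eq_one_iff]
    intro h
    have h2 : (natGenerator v : ℤ) ∣ 2 ^ 2 := by simpa using h
    have h2' : (natGenerator v : ℤ) ∣ 2 := (Nat.prime_iff_prime_int.mp hgen).dvd_of_dvd_pow h2
    have h2'' : natGenerator v ∣ 2 := by exact_mod_cast h2'
    exact hv ((Nat.prime_dvd_prime_iff_eq hgen Nat.prime_two).mp h2'')
  set k : ℚ := ((d : ℚ) - 1) / 4 with hk_def
  have hk4 : 4 * k + 1 = (d : ℚ) := by rw [hk_def]; ring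
  have hkv : v.valuation ℚ k ≤ 1 := by
    rw [hk_def, map_div₀, h4v, div_one,
      show ((d : ℚ) - 1) = algebraMap ℤ ℚ (d - 1) by rw [eq_intCast]; push_cast; ring]
    exact HeightOneSpectrum.valuation_le_one v (d - 1)
  have hk1 : v.valuation ℚ (4 * k + 1) = 1 := by rw [hk4]; exact hdv
  obtain ⟨C₁, -, hC₁⟩ := exists_variableChange_twistModel_eq_quadraticTwist V k
  rw [hk4] at hC₁
  haveI : (V.twistModel k).IsElliptic := by
    refine ⟨?_⟩
    rw [twistModel_Δ, hk4]
    exact (IsUnit.mk0 _ (pow_ne_zero 6 hd0)).mul V.isUnit_Δ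
  haveI : (V.quadraticTwist (d : ℚ)).IsElliptic := V.isElliptic_quadraticTwist hd0
  rw [← hC₁, conductorExponent_smul']
  exact conductorExponent_twistModel v V hkv hk1

/-- **Good reduction at `2` is preserved by the twist by `m ≡ 1 (mod 4)`**: for `E` good at `2`
and any model `W` of `E^{(m)}`, `W` is good at `2` (`f₂(W) = f₂(E^{(m)}) = f₂(E) = 0`).
[cite: SilvermanATAEC1994, IV.9.4 (PDF pp. 344–346)] [cite: Comalada1994, §2] -/
theorem hasGoodReductionAtPrime_two_of_smul_eq_quadraticTwist_of_emod_four_eq_one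
    {E : WeierstrassCurve ℚ} [E.IsElliptic] (hE : E.HasGoodReductionAtPrime 2) {m : ℤ} (hm : m % 4 = 1)
    (W : WeierstrassCurve ℚ) [W.IsElliptic] {C : VariableChange ℚ}
    (hC : C • W = E.quadraticTwist (m : ℚ)) : W.HasGoodReductionAtPrime 2 := by
  set v2 : HeightOneSpectrum ℤ := (primesEquiv (R := ℤ)).symm ⟨2, Nat.prime_two⟩ with hv2
  have hgen2 : natGenerator v2 = 2 := natGenerator_primesEquiv_symm Nat.prime_two
  have hm0 : (m : ℚ) ≠ 0 := by exact_mod_cast (show m ≠ 0 by omega)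
  haveI : (E.quadraticTwist (m : ℚ)).IsElliptic := E.isElliptic_quadraticTwist hm0
  have hfE : E.conductorExponent v2 = 0 := (conductorExponent_eq_zero_iff_holds v2 E).mpr
    ((E.hasGoodReductionAtPrime_iff_hasGoodReductionAt_holds ⟨2, Nat.prime_two⟩).mp hE)
  have hfW : W.conductorExponent v2 = 0 := by
    rw [← conductorExponent_smul' v2 W C, hC,
      conductorExponent_quadraticTwist_eq_of_not_dvd E hm v2 (by rw [hgen2]; omega), hfE]
  exact (W.hasGoodReductionAtPrime_iff_hasGoodReductionAt_holds ⟨2, Nat.prime_two⟩).mpr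
    ((conductorExponent_eq_zero_iff_holds v2 W).mp hfW)

/-! ## §2 The displayed hypotheses of the dyadic twist law, for a base good at `2` -/

/-- **Bookkeeping of a dyadic twist pair with GOOD partner.** `V` globally minimal good at `2`,
`d₂ ∈ {−1, 2, −2}`, `C • W = V^{(d₂)}`: then `W ∼ V^{(d₂)}`, `N(V) ∣ N(W)`, `(4|d₂|)² ∣ N(W)`
(`16` resp. `64`: `f₂(W) = 4` resp. `6` by Barrios et al. 2025 Thm. 5.1 row `I₀`, tree theorem
`conductorExponent_quadraticTwist_two_of_le_one_holds`; off `2` the exponents agree, §1), `4 ∤ N(V)`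
(`f₂(V) = 0`), and `W` is additive at `2` (`4 ∣ N(W)`, `not_good_and_not_mult_of_sq_dvd_conductorNorm`).
[cite: BarriosEtAl2025, Thm. 5.1, rows R = I₀, column (f, f^d) (arXiv pp. 15–16)]
[cite: SilvermanATAEC1994, IV.9.4 and IV.11.1 (Ogg's formula)] -/
theorem dyadicTwist_bookkeeping_of_hasGoodReductionAtPrime_two
    {V : WeierstrassCurve ℚ} [V.IsElliptic] [V.IsGloballyMinimal] (hV : V.HasGoodReductionAtPrime 2)
    {d₂ : ℤ} (hd₂ : d₂ = -1 ∨ d₂ = 2 ∨ d₂ = -2)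
    {W : WeierstrassCurve ℚ} [W.IsElliptic] {C : VariableChange ℚ}
    (hC : C • W = V.quadraticTwist (d₂ : ℚ)) :
    IsIsogenous W (V.quadraticTwist (d₂ : ℚ)) ∧ V.conductorNorm ℤ ∣ W.conductorNorm ℤ ∧
      (4 * d₂.natAbs) ^ 2 ∣ W.conductorNorm ℤ ∧ ¬ 2 ^ 2 ∣ V.conductorNorm ℤ ∧
      (¬ W.HasGoodReductionAtPrime 2 ∧ ¬ W.HasMultiplicativeReductionAtPrime 2) := by
  haveI : Fact (Nat.Prime 2) := ⟨Nat.prime_two⟩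
  set v2 : HeightOneSpectrum ℤ := (primesEquiv (R := ℤ)).symm ⟨2, Nat.prime_two⟩ with hv2
  have hgen2 : natGenerator v2 = 2 := natGenerator_primesEquiv_symm Nat.prime_two
  have hdne : d₂ ≠ 0 := by rcases hd₂ with rfl | rfl | rfl <;> norm_num
  have hd0 : (d₂ : ℚ) ≠ 0 := by exact_mod_cast hdne
  haveI : (V.quadraticTwist (d₂ : ℚ)).IsElliptic := V.isElliptic_quadraticTwist hd0
  -- `f₂(V) = 0`
  have hfV : V.conductorExponent v2 = 0 := (conductorExponent_eq_zero_iff_holds v2 V).mpr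
    ((V.hasGoodReductionAtPrime_iff_hasGoodReductionAt_holds ⟨2, Nat.prime_two⟩).mp hV)
  -- `f_p(W) = f_p(V^{(d₂)})` at every `p`
  have hfWp : ∀ p : Nat.Primes, W.conductorExponent ((primesEquiv (R := ℤ)).symm p) =
      (V.quadraticTwist (d₂ : ℚ)).conductorExponent ((primesEquiv (R := ℤ)).symm p) := fun p ↦ by
    rw [← conductorExponent_smul' _ W C, hC]
  -- Barrios et al.: `f₂(V^{(d₂)}) = 4` (`d₂ = −1`) resp. `6` (`d₂ = ±2`)
  have hB := conductorExponent_quadraticTwist_two_of_le_one_holds V v2 hgen2 (by omega) d₂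
  have key : (4 * d₂.natAbs) ^ 2 = 2 ^ W.conductorExponent v2 ∧ 2 ≤ W.conductorExponent v2 := by
    have hW2 := hfWp ⟨2, Nat.prime_two⟩
    rw [← hv2] at hW2
    rcases hd₂ with rfl | rfl | rfl
    · rw [hW2, hB.1 (by norm_num)]; decide
    · rw [hW2, hB.2 (by norm_num)]; decide
    · rw [hW2, hB.2 (by norm_num)]; decide
  have hN0 : W.conductorNorm ℤ ≠ 0 := (conductorNorm_pos_holds W).ne'
  have hfac : (W.conductorNorm ℤ).factorization 2 = W.conductorExponent v2 :=
    factorization_conductorNorm_primesEquiv_symm W ⟨2, Nat.prime_two⟩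
  have hmN : (4 * d₂.natAbs) ^ 2 ∣ W.conductorNorm ℤ := by
    rw [key.1]
    exact (Nat.prime_two.pow_dvd_iff_le_factorization hN0).mpr (by rw [hfac])
  have h4W : 2 ^ 2 ∣ W.conductorNorm ℤ :=
    (Nat.prime_two.pow_dvd_iff_le_factorization hN0).mpr (by rw [hfac]; exact key.2)
  have hadd := ManinAdditive.not_good_and_not_mult_of_sq_dvd_conductorNorm W h4W
  have h2V : ¬ 2 ∣ V.conductorNorm ℤ := fun h ↦
    (dvd_conductorNorm_iff_not_hasGoodReductionAtPrime V 2).mp h hV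
  have h4V : ¬ 2 ^ 2 ∣ V.conductorNorm ℤ := fun h ↦ h2V (dvd_trans ⟨2, by norm_num⟩ h)
  -- `N(V) ∣ N(W)`: at `2`, `0 ≤ f₂(W)`; off `2`, `f_p(V) = f_p(V^{(d₂)}) = f_p(W)`
  have hVW : V.conductorNorm ℤ ∣ W.conductorNorm ℤ := by
    refine conductorNorm_dvd_of_forall_conductorExponent_le V hN0 fun p ↦ ?_
    rw [factorization_conductorNorm_primesEquiv_symm W p]
    by_cases hp2 : (p : ℕ) = 2
    · have hp : p = ⟨2, Nat.prime_two⟩ := Subtype.ext hp2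
      subst hp
      rw [← hv2, hfV]
      exact Nat.zero_le _
    · have hgen : natGenerator ((primesEquiv (R := ℤ)).symm p) = p := natGenerator_primesEquiv_symm p.2
      have hpd : ¬ (natGenerator ((primesEquiv (R := ℤ)).symm p) : ℤ) ∣ d₂ := by
        rw [hgen]
        intro h
        have h2 : ((p : ℕ) : ℤ) ∣ 2 := by
          rcases hd₂ with rfl | rfl | rfl
          · exact (dvd_neg.mp h).trans (one_dvd _)
          · exact h
          · exact dvd_neg.mp h
        have h2' : (p : ℕ) ∣ 2 := by exact_mod_cast h2
        exact hp2 ((Nat.prime_dvd_prime_iff_eq p.2 Nat.prime_two).mp h2')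
      rw [hfWp p, conductorExponent_quadraticTwist_eq_of_odd_place V _ (by rw [hgen]; exact hp2) hpd]
  exact ⟨isIsogenous_of_smul_eq hC, hVW, hmN, h4V, hadd⟩

/-! ## §3 The engine: every square-free twist of a base good at `2` -/

/-- **The dyadic twist law applied**: `V` globally minimal good at `2`, `d₂ ∈ {−1, 2, −2}`, `W` a
GLOBALLY MINIMAL model of `V^{(d₂)}`; then every lattice-optimal `X₀`-datum `Dt` of `W` (any level) has
odd `c` — by §2 and the tree theorem `Theorems.twoNotDvdManinOfTwistOfSemistableAtTwo_holds` (cell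
`bsd-f2-manin`: Stevens 1989 (5.2)/(5.4) on `Γ₀`, `η = 1`, and its proved `η = 2` law) with `W₀ := W`,
modulo the printed facts `hM hAU hC2 hnf`. [cite: Stevens1989, Lemmas (5.2), (5.4), (5.6)–(5.7) pp. 96–98]
[cite: Cesnavicius2018, Thm. 1.2] [cite: Mazur1978, Cor. 4.1] [cite: AbbesUllmo1996, Thm. A] -/
theorem odd_c_of_latticeOptimal_of_smul_eq_dyadicTwist_of_hasGoodReductionAtPrime_two
    (hM : mazur_not_dvd_maninConstant_of_odd)
    (hAU : abbesUllmo_not_dvd_maninConstant_of_not_dvd_level)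
    (hC2 : cesnavicius_not_two_dvd_maninConstant_of_two_dvd_level) (hnf : exists_isNewformOf)
    {V : WeierstrassCurve ℚ} [V.IsElliptic] [V.IsGloballyMinimal] (hV : V.HasGoodReductionAtPrime 2)
    {d₂ : ℤ} (hd₂ : d₂ = -1 ∨ d₂ = 2 ∨ d₂ = -2)
    (W : WeierstrassCurve ℚ) [W.IsElliptic] [W.IsGloballyMinimal] {C : VariableChange ℚ}
    (hC : C • W = V.quadraticTwist (d₂ : ℚ)) {N : ℕ} [NeZero N] (Dt : ModularParametrizationData W N)
    (hopt : ∀ z ∈ Dt.L.lattice, ∃ w ∈ periodLattice Dt.f, z = (Dt.c : ℂ) * w) : Odd Dt.c := by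
  obtain ⟨hiso, hN'N, hmN, h4V, hadd⟩ := dyadicTwist_bookkeeping_of_hasGoodReductionAtPrime_two hV hd₂ hC
  have h : ¬ (2 : ℤ) ∣ Dt.maninConstant :=
    Summit.BirchSwinnertonDyer.BirchSwinnertonDyer.Theorems.twoNotDvdManinOfTwistOfSemistableAtTwo_holds
      hM hAU hC2 hnf hd₂ hiso hN'N hmN h4V hadd W Dt (IsIsogenous.refl_holds W) hopt
  exact Int.not_even_iff_odd.mp fun he ↦ h (even_iff_two_dvd.mp he)

/-- **Square-free integers are `≡ 1 (mod 4)` or `m*·d₂` with `m* ≡ 1 (mod 4)`, `d₂ ∈ {−1, 2, −2}`**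
(`d ≡ 3`: `d = (−d)(−1)`; `d = 2(2k+1)`: `d = (2k+1)·2` or `(−(2k+1))(−2)`; `4 ∤ d`). [folklore] -/
theorem emod_four_eq_one_or_exists_dyadic {d : ℤ} (hsq : Squarefree d) :
    d % 4 = 1 ∨ ∃ m d₂ : ℤ, m % 4 = 1 ∧ (d₂ = -1 ∨ d₂ = 2 ∨ d₂ = -2) ∧ d = m * d₂ := by
  have h4 : ¬ (4 : ℤ) ∣ d := fun h ↦ by
    have h2 : IsUnit (2 : ℤ) := hsq 2 (by rw [show (2 : ℤ) * 2 = 4 by norm_num]; exact h)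
    rcases Int.isUnit_iff.mp h2 with h | h <;> norm_num at h
  rcases (show d % 4 = 1 ∨ d % 4 = 2 ∨ d % 4 = 3 by omega) with h | h | h
  · exact Or.inl h
  · right
    obtain ⟨k, hk⟩ : ∃ k : ℤ, d = 4 * k + 2 := ⟨d / 4, by omega⟩
    rcases (show (2 * k + 1) % 4 = 1 ∨ (2 * k + 1) % 4 = 3 by omega) with h' | h'
    · exact ⟨2 * k + 1, 2, h', Or.inr (Or.inl rfl), by omega⟩
    · exact ⟨-(2 * k + 1), -2, by omega, Or.inr (Or.inr rfl), by omega⟩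
  · exact Or.inr ⟨-d, -1, by omega, Or.inl rfl, by omega⟩

/-- **THE ENGINE.** `E` globally minimal GOOD at `2`, `d ≠ 0` square-free, `W` a globally minimal model
of `E^{(d)}` (`C • W = E.quadraticTwist d`): every lattice-optimal `X₀`-datum `Dt` of `W` at any level
`N` has odd `c`, modulo `hM hAU hC2 hnf`. Case `d ≡ 1 (4)`: `W` is good at `2` (§1), `N = N(W)`
(modularity, `IsNewformOf.level_eq_conductorNorm_of_exists_isNewformOf`), so `2 ∤ N` and Abbes–Ullmo
gives `2 ∤ c`. Otherwise `d = m*·d₂` (`emod_four_eq_one_or_exists_dyadic`), the globally minimal model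
`V` of `E^{(m*)}` is good at `2` (§1), and `W ≅ V^{(d₂)}` (`quadraticTwist_smul`,
`quadraticTwist_quadraticTwist`): the dyadic twist law applies (§2–§3).
[cite: Stevens1989, Lemmas (5.2), (5.4) pp. 96–97] [cite: Cesnavicius2018, Thm. 1.2]
[cite: AbbesUllmo1996, Thm. A] [cite: BarriosEtAl2025, Thm. 5.1] [cite: SilvermanAEC2009, X.5 Cor. 5.4.1] -/
theorem odd_c_of_latticeOptimal_of_smul_eq_quadraticTwist_of_hasGoodReductionAtPrime_two
    (hM : mazur_not_dvd_maninConstant_of_odd)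
    (hAU : abbesUllmo_not_dvd_maninConstant_of_not_dvd_level)
    (hC2 : cesnavicius_not_two_dvd_maninConstant_of_two_dvd_level) (hnf : exists_isNewformOf)
    {E : WeierstrassCurve ℚ} [E.IsElliptic] [E.IsGloballyMinimal] (hE : E.HasGoodReductionAtPrime 2)
    {d : ℤ} (hd0 : d ≠ 0) (hsq : Squarefree d)
    (W : WeierstrassCurve ℚ) [W.IsElliptic] [W.IsGloballyMinimal] {C : VariableChange ℚ}
    (hC : C • W = E.quadraticTwist (d : ℚ)) {N : ℕ} [NeZero N] (Dt : ModularParametrizationData W N)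
    (hopt : ∀ z ∈ Dt.L.lattice, ∃ w ∈ periodLattice Dt.f, z = (Dt.c : ℂ) * w) : Odd Dt.c := by
  haveI : Fact (Nat.Prime 2) := ⟨Nat.prime_two⟩
  rcases emod_four_eq_one_or_exists_dyadic hsq with h1 | ⟨m, d₂, hm, hd₂, rfl⟩
  · -- good at `2`: Abbes–Ullmo at `p = 2`
    have hgood : W.HasGoodReductionAtPrime 2 :=
      hasGoodReductionAtPrime_two_of_smul_eq_quadraticTwist_of_emod_four_eq_one hE h1 W hC
    have h2N : ¬ 2 ∣ W.conductorNorm ℤ := fun h ↦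
      (dvd_conductorNorm_iff_not_hasGoodReductionAtPrime W 2).mp h hgood
    have hN : N = W.conductorNorm ℤ := IsNewformOf.level_eq_conductorNorm_of_exists_isNewformOf hnf Dt.isNewformOf
    have h : ¬ (2 : ℤ) ∣ Dt.maninConstant := hAU W Dt hopt 2 Nat.prime_two (by rw [hN]; exact h2N)
    exact Int.not_even_iff_odd.mp fun he ↦ h (even_iff_two_dvd.mp he)
  · -- `d = m d₂`: the partner `V` = minimal model of `E^{(m)}`, good at `2`, and `W ≅ V^{(d₂)}`
    have hm0 : (m : ℚ) ≠ 0 := by exact_mod_cast (show m ≠ 0 by omega)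
    haveI : (E.quadraticTwist (m : ℚ)).IsElliptic := E.isElliptic_quadraticTwist hm0
    obtain ⟨u, hu⟩ := hasGlobalMinimalModel_rat_holds (E.quadraticTwist (m : ℚ))
    haveI := hu
    have hV : (u • E.quadraticTwist (m : ℚ)).HasGoodReductionAtPrime 2 :=
      hasGoodReductionAtPrime_two_of_smul_eq_quadraticTwist_of_emod_four_eq_one hE hm
        (u • E.quadraticTwist (m : ℚ)) (C := u⁻¹) (inv_smul_smul u _)
    have hC' : ((⟨u.u, (d₂ : ℚ) * u.r, 0, 0⟩ : VariableChange ℚ) * C) • W =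
        (u • E.quadraticTwist (m : ℚ)).quadraticTwist (d₂ : ℚ) := by
      rw [mul_smul, hC, quadraticTwist_smul, quadraticTwist_quadraticTwist]
      push_cast
      rfl
    exact odd_c_of_latticeOptimal_of_smul_eq_dyadicTwist_of_hasGoodReductionAtPrime_two hM hAU hC2 hnf
      hV hd₂ W hC' Dt hopt

/-- The same in `j`-currency for ONE base: `E` globally minimal good at `2` with `j(E) ≠ 0, 1728`, `W`
globally minimal with `j(W) = j(E)` (so `W ≅ E^{(d)}` with `d` square-free,
`exists_variableChange_eq_quadraticTwist_intCast_of_j_eq`) ⟹ every lattice-optimal datum of `W` has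
odd `c`, modulo `hM hAU hC2 hnf`. [cite: SilvermanAEC2009, X.5 Prop. 5.4 and Cor. 5.4.1]
[cite: Stevens1989, Lemmas (5.2), (5.4)] [cite: AbbesUllmo1996, Thm. A] -/
theorem odd_c_of_latticeOptimal_of_j_eq_of_hasGoodReductionAtPrime_two
    (hM : mazur_not_dvd_maninConstant_of_odd)
    (hAU : abbesUllmo_not_dvd_maninConstant_of_not_dvd_level)
    (hC2 : cesnavicius_not_two_dvd_maninConstant_of_two_dvd_level) (hnf : exists_isNewformOf)
    (E : WeierstrassCurve ℚ) [E.IsElliptic] [E.IsGloballyMinimal] (hE : E.HasGoodReductionAtPrime 2)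
    (h0 : E.j ≠ 0) (h1728 : E.j ≠ 1728)
    (W : WeierstrassCurve ℚ) [W.IsElliptic] [W.IsGloballyMinimal] (hj : W.j = E.j)
    {N : ℕ} [NeZero N] (Dt : ModularParametrizationData W N)
    (hopt : ∀ z ∈ Dt.L.lattice, ∃ w ∈ periodLattice Dt.f, z = (Dt.c : ℂ) * w) : Odd Dt.c := by
  obtain ⟨d, hd0, hsq, C, hC⟩ := exists_variableChange_eq_quadraticTwist_intCast_of_j_eq hj h0 h1728
  exact odd_c_of_latticeOptimal_of_smul_eq_quadraticTwist_of_hasGoodReductionAtPrime_two hM hAU hC2 hnf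
    hE hd0 hsq W hC Dt hopt

end Summit.BirchSwinnertonDyer.Rank1Residual.P2.OddManinTwistRoad

end
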